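import Summits.BirchSwinnertonDyer.Rank1Residual.ManinAdditive.ALTateCohomology
import Summits.BirchSwinnertonDyer.Rank1Residual.ManinAdditive.ConwayCut
import HarnessLib
import HarnessLib.Audit.Tags

/-!
TYPER HEADER (bsd-f2-manin-ty g16, 2026-08-29; T-desc-19) — desc g15 `HOME/desc/g15/Sketch-desc-g15.lean` sha16 8b21a6c96d77a328
landed VERBATIM (205 l.; farm rc 0 · 0 sorries · 0 warnings per desc and re-checked by the typer), with ONE bookkeeping change:
the namespace `…ManinAdditive.DescG15` is folded to the topic namespace `…ManinAdditive.KMCuspTate` (file-named, like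
`ALTateCohomology` / `ConwayCut`).  CONTENT: ten `@[conjecture]` CANDIDATE ROWS of the -desc lens (E-desc-92 `KMTateH0GenusLaw`,
E-desc-93 `KMTateH1NewformLaw`, E-desc-94 `KMCuspIndexLaw`, E-desc-95 `KMNewformMinusSlackOneLaw`, E-desc-76R
`ALTateOneSidedLawAtTwoR`, E-desc-91 `ALTateOneSidedLawAtEight`, E-desc-91♯ `ALTateFixedPointLawAtEight`, E-desc-96
`KMTateLawAtEight`, E-desc-97 `KMTateOneSidedAtEightOfThreeModFour`, E-desc-98 `KMSlackOneEisensteinLawAtEight`) — each an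
OBLIGATION NODE, nothing asserted, census / pre-registration counts as stated by desc (MEMO-desc §32–§33, PREREG-KM-g15.txt
73006b788e563dd9, PREREG-KM8-g15.txt f61db5babd873b3d; ref1 §R88, §R102) — plus five closed-form level invariants with bodies
(`cuspCount`, `ellipticTwoCount`, `genusXZero`, `wFourFixedPointCount`, `ssRationalCountAtTwo`) and ONE proved edge
`altateOneSidedLawAtEight_of_fixedPointLaw` (E-91♯ → E-91).  RECORD: E-desc-76 `ALTateCohomology.ALTateOneSidedLawAtTwo` was
refuted AS TYPED (ref1 §R88; counterexamples listed in the E-76R docstring) and stays in the tree as the record; E-desc-76R below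
is its repair (`¬ 16 ∣ N` ↦ `¬ 8 ∣ N`), not an edit of the old node.  APPEND 2026-08-29 (typer g16): E-desc-96 REFUTED AS TYPED at `N = 8`
(`kmTateLawAtEight_false`, p684174) → repaired row **E-desc-96R `KMTateLawAtEightR`** (binder `N ≠ 8`) + edge; SUPERSEDED paragraph on E-96.  HONEST FRAMING: laws of a computational lens; BSD is not
proved by this; Manin's conjecture is not proved by this; C2 OPEN.
-/

/-!
# desc g15 (typed as `KMCuspTate`) — the Katz–Mazur cusp lattice at `4 ∥ N` and `8 ∥ N` as a `ℤ[C₂]`-lattice under `w_4` / `w_8`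
(cell bsd-f2-manin, lens -desc, MEMO-desc §33; typed candidate rows E-desc-92 … E-desc-97, E-desc-76R, E-desc-91/91♯)

Objects (all tree declarations): `S = integralCuspForms0 N 2`; the two-cusp lattice `L_{Q₂} = alCutLattice N 2 = S ∩ w⁻¹S`
(`w = w_{2^{v₂(N)}}`); the Katz–Mazur cusp lattice `Λ = kmCuspLattice N = S ⊓ wS ⊓ t(wS) ⊓ w(t(wS))` (`t = halfTranslate N 2`,
`z ↦ z + ½`), which at `v₂(N) = 2` is `H⁰(X₀(N)_{ℤ₍₂₎}, Ω) = H⁰(𝒥₀(N)_{ℤ₍₂₎}, Ω¹)` (Česnavičius–Neururer–Saha 2022 §1 + the cell's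
THEOREM N=C, MEMO-imc §24) and at `v₂(N) = 3` is `H⁰(X₀(N)_{ℤ₍₂₎}, Ω)`, equal to the Néron lattice when some prime `q ≡ 3 (4)`
divides `N`.  `tateOrder L w ε = #Ĥ⁰ / #H¹` of `⟨w⟩` on `L` (orders `2^{t₊}`, `2^{t₋}`).

LAWS (E-blind censuses by the g15 engine `km_tate.py`, HOME/desc/g15/; `N = 4M ≤ 444`: 54 levels, 47 of them predicted
from the closed form BEFORE the run — PREREG-KM-g15.txt sha16 73006b788e563dd9 — and confirmed 47/47, pilot 7/7;
`N = 8M ≤ 440`: 27 levels):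
* `v₂(N) = 2`, `M = N/4`:  `t₊(Λ) = g(X₀(M))`,  `t₋(Λ) = g(X₀(M)) − 1 + ν₄/2 = dim S₂^{new}(Γ₀(4M))`,  `ν₄ = c(M) + e₂(M)`
  (= number of fixed points of `w_4` on `X₀(4M)`), `[L_{Q₂} : Λ] = 2^{g(X₀(M))}`, and every newform of level `4M` has
  `w_4 = −1` and slack one on `Λ` (`[e_f Λ : ℤf] = [e_f Λ⁻ : ℤf]`, 210/210 new basis vectors, 80 of them optimal elliptic curves).
* `v₂(N) = 3`, `M = N/8`:  on `L_{Q₂}`: `(t₊, t₋) = ([ν₈ = 0], max(ν₈/2 − 1, 0))` (E-desc-91♯, 27/27; ref1 §R102 37/37 to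
  `N ≤ 1000`), `ν₈ = alFixedPointCount N 8 = 2∏_{q∣M}(1 + (−2/q))`;  on `Λ`: `(t₊, t₋) = (e₂(M)/2 + [f = 0],
  e₂(M)/2 + [f = 0] + ν₈/2 − 1)` with `f = ν₈/4 + e₂(M)/2 = #X₀(M)^{ss}(𝔽₂)` (27/27) — so `Λ` is one-sided at `8 ∥ N`
  iff `e₂(M) = 0` or (`ν₈ = 0` and `e₂(M) = 2`); NOT one-sided at `N = 136, 328` (`(t₊,t₋) = (1,2)`).
Paper mechanism (MEMO-desc §33.3): Rosenlicht differentials on the Katz–Mazur fibre `X₀(2^v M)_{𝔽₂} = ⋃_{a+b=v} C_{(a,b)}`,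
`w̄` = swap `(a,b) ↔ (b,a)` composed with Frobenius on the supersingular locus, Krull–Schmidt for `ℤ₂[C₂]`-lattices,
holomorphic Lefschetz (`t₋ − t₊ = ν/2 − 1`).  Nothing here is asserted as a theorem; BSD is not proved by this.
-/

noncomputable section

open scoped MatrixGroups ModularForm

open CongruenceSubgroup WeierstrassCurve Literature.NumberTheory.EllipticCurves.ModularForms

namespace Summit.BirchSwinnertonDyer.Rank1Residual.ManinAdditive.KMCuspTate

open ALSignCongruence ALTateCohomology ConwayCut

/-! ### Elementary level invariants of `X₀(M)` (closed forms; `M` odd where used) -/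

/-- `c(M) = Σ_{d ∣ M} φ(gcd(d, M/d))`, the number of cusps of `X₀(M)`. -/
def cuspCount (M : ℕ) : ℕ := ∑ d ∈ M.divisors, Nat.totient (Nat.gcd d (M / d))

/-- `e₂(M) = ∏_{q ∣ M} (1 + (−1/q))` for ODD `M`: the number of elliptic points of order 2 of `X₀(M)` (= twice the number of
supersingular points of `X₀(M)_{𝔽̄₂}` with an automorphism of order 4). -/
def ellipticTwoCount (M : ℕ) : ℤ := ∏ q ∈ M.primeFactors, (1 + jacobiSym (-1) q)

/-- `g(X₀(M)) = dim_ℂ S₂(Γ₀(M))`. -/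
def genusXZero (M : ℕ) [NeZero M] : ℕ := Module.finrank ℂ (CuspForm (Gamma0 M) 2)

/-- `ν₄(4M) = c(M) + e₂(M)`: the number of fixed points of `w_4` on `X₀(4M)(ℂ)` for odd `M` (the `c(M)` cusps `x/(2d)` and the
`e₂(M)` CM points by `ℤ[i]`; Ogg 1974 Prop. 3 shape).  Census: `2g(X₀(4M)) + 2 − 4 dim S₂(4M)^{w_4=+} = c(M) + e₂(M)` at 54/54
levels `4M ≤ 444`. -/
def wFourFixedPointCount (M : ℕ) : ℤ := (cuspCount M : ℤ) + ellipticTwoCount M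

/-- `f₂(M) = ν₈/4 + e₂(M)/2 = ½∏_{q∣M}(1 + (−2/q)) + ½∏_{q∣M}(1 + (−1/q))` (odd `M > 1`): the number of `𝔽₂`-RATIONAL
supersingular points of `X₀(M)_{𝔽₂}` (eigenlines of the norm-2 endomorphisms `√−2`, `1 ± i` of the Hurwitz order; MEMO-desc
§33.4, engine `ssfrob.py` 29/29 for `M ≤ 55` and `M = 65, 85`). Stated with `ν₈ = alFixedPointCount N 8`. -/
def ssRationalCountAtTwo (N : ℕ) : ℤ := alFixedPointCount N 8 / 4 + ellipticTwoCount (N / 8) / 2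

/-! ### `v₂(N) = 2`: the `ℤ[w_4]`-structure of the Katz–Mazur cusp lattice (LAW KM-B, pre-registered 47/47 + pilot 7/7) -/

/-- **E-desc-92 `KMTateH0GenusLaw`** (LAW KM-B, clause P2; MEMO-desc §33.2).  `4 ∥ N`, `M = N/4`:
`#Ĥ⁰(⟨w_4⟩, Λ) = 2^{g(X₀(M))}`; moreover `Ĥ⁰` has basis the classes of `φ(2τ)`, `φ ∈ S₂(Γ₀(M); 𝔽₂)` (clause S1, 54/54) and
the old forms die in `H¹` (S2, 54/54).  Paper: `Λ ⊗ 𝔽̄₂ = H⁰(X_{𝔽̄₂}, ω)` (Rosenlicht), `w̄_4` fixes the component `C_{(1,1)} ≅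
X₀(M)` pointwise and swaps `C_{(2,0)} ↔ C_{(0,2)}`.  Why it might fail: the local invariant count at the `e₂(M)/2` crossing
points with automorphism `i` (wild stabiliser) is ASSUMED generic (δ = 3, two conditions) — consistent 54/54, unproved.
TYPER FRAMING (E-desc-92): lens desc; LAW (census 54/54, 47 pre-registered), nothing asserted. [conjecture — cell candidate, NOT a tree fact] -/
@[conjecture]
def KMTateH0GenusLaw : Prop :=
  ∀ (N : ℕ) [NeZero N] [NeZero (N / 4)], 4 ∣ N → ¬ 8 ∣ N →
    tateOrder (kmCuspLattice N) (wZ N 2) 1 = 2 ^ genusXZero (N / 4)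

/-- **E-desc-93 `KMTateH1NewformLaw`** (LAW KM-B, clause P3; MEMO-desc §33.2).  `4 ∥ N`, `M = N/4`:
`#H¹(⟨w_4⟩, Λ) = 2^{g(X₀(M)) − 1 + ν₄/2}`, `ν₄ = c(M) + e₂(M)`; the exponent equals `dim S₂^{new}(Γ₀(4M)) = h(M) − e₃(M)`
(`h(M)` = number of supersingular points of `X₀(M)_{𝔽̄₂}`), and then (given E-desc-92/S2) `H¹(⟨w_4⟩, Λ) = Λ⁻/(Λ⁻ ∩ V_old + 2Λ⁻)`
canonically — «`H¹` is the space of newforms of level `4M` mod 2».  54/54.  Why it might fail: as E-desc-92.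
TYPER FRAMING (E-desc-93): lens desc; LAW (census 54/54), nothing asserted. [conjecture — cell candidate, NOT a tree fact] -/
@[conjecture]
def KMTateH1NewformLaw : Prop :=
  ∀ (N : ℕ) [NeZero N] [NeZero (N / 4)], 4 ∣ N → ¬ 8 ∣ N →
    (tateOrder (kmCuspLattice N) (wZ N 2) (-1) : ℤ) =
      2 ^ Int.toNat ((genusXZero (N / 4) : ℤ) - 1 + wFourFixedPointCount (N / 4) / 2)

/-- **E-desc-94 `KMCuspIndexLaw`** (LAW KM-B, clause X1; MEMO-desc §33.2).  `4 ∥ N`: the Katz–Mazur cusp lattice has index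
`2^{g(X₀(N/4))}` in the two-cusp lattice `L_{Q₂} = S ∩ w_4⁻¹ S` (54/54) — the integrality conditions at the `c(M)` middle
cusps `x/(2d)` cut exactly one factor 2 per level-`M` form.  Why it might fail: an extra middle-cusp condition at levels with
`9 ∣ M` or `M` square beyond the census (`M ≤ 111`).
TYPER FRAMING (E-desc-94): lens desc; LAW (census 54/54), nothing asserted. [conjecture — cell candidate, NOT a tree fact] -/
@[conjecture]
def KMCuspIndexLaw : Prop :=
  ∀ (N : ℕ) [NeZero N] [NeZero (N / 4)], 4 ∣ N → ¬ 8 ∣ N →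
    (kmCuspLattice N).toAddSubgroup.relIndex (alCutLattice N 2).toAddSubgroup = 2 ^ genusXZero (N / 4)

/-- **E-desc-95 `KMNewformMinusSlackOneLaw`** (E-facing; MEMO-desc §33.5).  `E/ℚ` elliptic of conductor `N` with `4 ∥ N`,
`D` a modular parametrisation datum of level `N` (`f = D.f` the newform): (i) `w_4 f = −f` (every newform of level `4M` is
`w_4`-minus: elementary from holomorphic Lefschetz `tr(w_4 | S₂(4M)) = 1 − ν₄/2`, the oldform traces `g(X₀(M))` and `0`, and
`dim S₂^{new}(4M) = g(X₀(M)) − 1 + ν₄/2`; census 210/210 new basis vectors at `4M ≤ 444`); (ii) SLACK ONE on the Katz–Mazur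
(= Néron at `v₂ = 2`) lattice: `[e_f Λ : ℤf] = [e_f Λ⁻ : ℤf]`, i.e. the mod-2 `f`-functional of `Λ⁻` factors through
`H¹(⟨w_4⟩, Λ)` (corollary of E-desc-93's `H¹ = Λ⁻/(Λ⁻_old + 2Λ⁻)`; census 210/210, 80 optimal curves, versus slack 2 at 95/210
on `L_{Q₂}`).  Why it might fail: (i) cannot at `4 ∥ N` if the trace identity is right; (ii) fails iff E-desc-93 fails.
TYPER FRAMING (E-desc-95): lens desc; LAW, E-facing (census 210/210), nothing asserted. [conjecture — cell candidate, NOT a tree fact] -/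
@[conjecture]
def KMNewformMinusSlackOneLaw : Prop :=
  ∀ (W : WeierstrassCurve ℚ) [W.IsElliptic] [NeZero (W.conductorNorm ℤ)]
    (D : ModularParametrizationData W (W.conductorNorm ℤ)),
    4 ∣ W.conductorNorm ℤ → ¬ 8 ∣ W.conductorNorm ℤ →
      atkinLehnerInvolutionAt (W.conductorNorm ℤ) 2 2 D.f = (-1 : ℂ) • D.f ∧
        lineIndex (kmCuspLattice (W.conductorNorm ℤ)) D.f =
          lineIndex (kmCuspLattice (W.conductorNorm ℤ) ⊓
            LinearMap.ker (wZ (W.conductorNorm ℤ) 2 + LinearMap.id)) D.f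

/-! ### `2 ∣ N`, `Q` odd: the repaired one-sided law (E-desc-76R) -/

/-- **E-desc-76R `ALTateOneSidedLawAtTwoR`** — REPAIR of the refuted-misstated E-desc-76 `ALTateOneSidedLawAtTwo`
(killed AS TYPED at `(N,p) = (168,3), (264,11), (312,3), (440,11), (456,3), (472,59), (792,11)`, all with `8 ∣ N`; ref1 §R88):
the binder `¬ 16 ∣ N` is replaced by `¬ 8 ∣ N`.  For `N` with `v₂(N) ∈ {1, 2}` and an odd prime `p ∣ N`, the two-cusp lattice
at 2 and `p`, `L_{Q_p} ∩ L_{Q₂}`, is a ONE-SIDED `ℤ[w_{Q_p}]`-lattice: `Ĥ⁰ = 0` or `H¹ = 0`.  Census C′₁ (ref1 e88, independent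
engine): 338/338 cells `(N, p)`, `2 ∣ N`, `8 ∤ N`, `N ≤ 800`.  Why it might fail: a level `4M` with a `w_{Q_p}`-fixed
configuration on the component `C_{(1,1)}` not seen below 800.
TYPER FRAMING (E-desc-76R): lens desc; REPAIRED LAW (census 338/338, ref1 e88), nothing asserted; supersedes the refuted-as-typed E-desc-76. [conjecture — cell candidate, NOT a tree fact] -/
@[conjecture]
def ALTateOneSidedLawAtTwoR : Prop :=
  ∀ (N : ℕ) [NeZero N] (p : ℕ), p.Prime → p ≠ 2 → p ∣ N → 2 ∣ N → ¬ 8 ∣ N →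
    tateOrder (alCutLatticeAtTwo N p) (wZ N p) 1 = 1 ∨ tateOrder (alCutLatticeAtTwo N p) (wZ N p) (-1) = 1

/-! ### `v₂(N) = 3`: the two-cusp lattice is one-sided (E-desc-91), with the THEOREM-A shape (E-desc-91♯) -/

/-- **E-desc-91 `ALTateOneSidedLawAtEight`** (MEMO-desc §32, §33.4).  `8 ∥ N`: the two-cusp lattice `L_{Q₂} = S ∩ w_8⁻¹S` is a
one-sided `ℤ[w_8]`-lattice.  Census: desc g15 27/27 (`8M ≤ 440`), ref1 §R102 37/37 (`8 ∥ N ≤ 1000`, second engine).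
Why it might fail: a level `8M` where a `w_8`-plus old configuration from level `2M` survives in `Ĥ⁰` together with `ν₈ > 0`.
TYPER FRAMING (E-desc-91): lens desc; LAW (census 27/27 + ref1 37/37), nothing asserted. [conjecture — cell candidate, NOT a tree fact] -/
@[conjecture]
def ALTateOneSidedLawAtEight : Prop :=
  ∀ (N : ℕ) [NeZero N], 8 ∣ N → ¬ 16 ∣ N → tateH0Order N 2 = 1 ∨ tateH1Order N 2 = 1

/-- **E-desc-91♯ `ALTateFixedPointLawAtEight`** — the exact orders (THEOREM-A shape at `8 ∥ N`): `#Ĥ⁰(⟨w_8⟩, L_{Q₂}) =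
2^{[ν₈ = 0]}`, `#H¹ = 2^{max(ν₈/2 − 1, 0)}`, `ν₈ = alFixedPointCount N 8 = h(−32)∏_{q ∣ N/8}(1 + (−32/q)) = 2∏(1 + (−2/q))`
(27/27, `8M ≤ 440`).  Why it might fail: as E-desc-91; the class-number form of `ν₈` at `M` divisible by `9` or a square
(checked at `M = 9, 25, 27, 45, 49` only).
TYPER FRAMING (E-desc-91♯): lens desc; LAW (census 27/27), nothing asserted. [conjecture — cell candidate, NOT a tree fact] -/
@[conjecture]
def ALTateFixedPointLawAtEight : Prop :=
  ∀ (N : ℕ) [NeZero N], 8 ∣ N → ¬ 16 ∣ N →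
    (tateH0Order N 2 = if alFixedPointCount N 8 = 0 then 2 else 1) ∧
      tateH1Order N 2 = 2 ^ Int.toNat (alFixedPointCount N 8 / 2 - 1)

/-- PROVED edge: the exact law implies the one-sided law. -/
theorem altateOneSidedLawAtEight_of_fixedPointLaw (h : ALTateFixedPointLawAtEight) : ALTateOneSidedLawAtEight := by
  intro N _ h8 h16
  obtain ⟨h0, h1⟩ := h N h8 h16
  by_cases hν : alFixedPointCount N 8 = 0
  · right
    rw [h1, hν]
    decide
  · left
    rw [h0, if_neg hν]

/-! ### `v₂(N) = 3`: the Katz–Mazur cusp lattice (LAW KM-8) -/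

/-- **E-desc-96 `KMTateLawAtEight`** (LAW KM-8; MEMO-desc §33.4).  `8 ∥ N`, `M = N/8`, `f = ν₈/4 + e₂(M)/2`
(= `#X₀(M)^{ss}(𝔽₂)`): `t₊(Λ) = e₂(M)/2 + [f = 0]`, `t₋(Λ) = e₂(M)/2 + [f = 0] + ν₈/2 − 1`.  FITTED on the 27 levels
`8M ≤ 440` (27/27) from the Rosenlicht model (generic 4-branch crossing: δ = 8, 3 invariant conditions; `μ₃`-crossing: 1;
Frobenius-swapped pairs: 0; one residue dependency iff `f = 0`); OUT-OF-SAMPLE PREDICTIONS registered in MEMO-desc §33.4: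
`(t₊,t₋)(8M) = (2,1)` at `M = 65, 85`, `(1,2)` at `M = 73, 89, 97, 113` (untested; ask D-desc-18).  Why it might fail: the
count at `𝔽₂`-rational crossing points with automorphism `i` (net `+2` to `t₊ + t₋`, fitted, not derived) may change when
two such points occur (`e₂(M) = 4`).
REFUTED AS TYPED (refuter-1 g13, 2026-08-29T01:05Z, §R105): `kmTateLawAtEight_false : ¬ KMTateLawAtEight`
(`Summits/BirchSwinnertonDyer/BirchSwinnertonDyer/Theorems/ManinOddAtFour/Negative/KMTateLawAtEightFalse.lean`, p684174) — at the
degenerate level `N = 8` (`M = 1`, outside the census) `S₂(Γ₀(8)) = 0`, so both Tate orders are `1`, while the integer divisions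
truncate (`e₂(1)/2 = 0`, `ν₈(8)/4 = 0`, `ssRationalCountAtTwo 8 = 0`) and the law predicts `#Ĥ⁰ = 2`.  CLASS refuted-misstated;
SUPERSEDED by **`KMTateLawAtEightR`** below (binder `N ≠ 8` added, everything else verbatim); this node is kept as the record.
TYPER FRAMING (E-desc-96): lens desc; FITTED LAW (27/27) with registered out-of-sample predictions, nothing asserted. [conjecture — cell candidate, NOT a tree fact] -/
@[conjecture]
def KMTateLawAtEight : Prop :=
  ∀ (N : ℕ) [NeZero N], 8 ∣ N → ¬ 16 ∣ N →
    ((tateOrder (kmCuspLattice N) (wZ N 2) 1 : ℤ) =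
        2 ^ Int.toNat (ellipticTwoCount (N / 8) / 2 + (if ssRationalCountAtTwo N = 0 then 1 else 0))) ∧
      ((tateOrder (kmCuspLattice N) (wZ N 2) (-1) : ℤ) =
        2 ^ Int.toNat (ellipticTwoCount (N / 8) / 2 + (if ssRationalCountAtTwo N = 0 then 1 else 0) +
          alFixedPointCount N 8 / 2 - 1))

/-- **E-desc-97 `KMTateOneSidedAtEightOfThreeModFour`** (MEMO-desc §33.4).  `8 ∥ N` and some prime `q ≡ 3 (mod 4)` divides
`N` — exactly the Česnavičius–Neururer–Saha rational-singularity regime in which `Λ ⊗ ℤ₂ = H⁰(𝒥₀(N)_{ℤ₂}, Ω¹)` is known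
(cell THEOREM N=C (b)): then the NÉRON lattice is a one-sided `ℤ[w_8]`-lattice.  Corollary of E-desc-96 (`e₂(N/8) = 0`);
census 19/19 such levels `8M ≤ 440`; without the hypothesis it is FALSE at `N = 136 = 8·17`, `328 = 8·41` (`(t₊,t₋) = (1,2)`)
and (predicted) at `8·65, 8·73, 8·85, …`.  Why it might fail: as E-desc-96 restricted to `e₂ = 0` (there only generic and
`μ₃` crossings occur, both derived on paper) — the remaining gap is `Λ ⊗ 𝔽̄₂ = H⁰(X_{𝔽̄₂}, ω)` for the Katz–Mazur model.
TYPER FRAMING (E-desc-97): lens desc; LAW (census 19/19), nothing asserted. [conjecture — cell candidate, NOT a tree fact] -/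
@[conjecture]
def KMTateOneSidedAtEightOfThreeModFour : Prop :=
  ∀ (N : ℕ) [NeZero N], 8 ∣ N → ¬ 16 ∣ N → (∃ q : ℕ, q.Prime ∧ q ∣ N ∧ q % 4 = 3) →
    tateOrder (kmCuspLattice N) (wZ N 2) 1 = 1 ∨ tateOrder (kmCuspLattice N) (wZ N 2) (-1) = 1

/-! ### `v₂(N) = 3`: slack one on the Katz–Mazur lattice is Eisenstein (E-desc-98) -/

/-- **E-desc-98 `KMSlackOneEisensteinLawAtEight`** (E-facing; MEMO-desc §33.10; the `8 ∥ N` analogue of E-desc-74/82 on the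
Katz–Mazur lattice).  `E/ℚ` of conductor `N`, `8 ∥ N`, `f = D.f` with `w_8 f = ε f`; if the slack of `f` on `Λ = kmCuspLattice N`
is one, `[e_f Λ : ℤf] = [e_f Λ^{ε} : ℤf]`, then `f` is Eisenstein or dihedral-at-2 mod 2: `E(ℚ)[2] ≠ 0`, or `−2Δ_E` or `−Δ_E` is a
square.  Census (SLACKTALLY-g15, 69 optimal curves at `8M ≤ 440`): slack one at 8 curves (40a1, 56b1, 120b1, 184c1, 328b1 with
`ε = +1`; 24a1, 136a1, 136b1 with `ε = −1`), ALL 8 with a rational 2-torsion point; 32 torsion curves have slack 2 (no converse).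
Why it might fail: a slack-one curve at `8M` whose mod-2 image is `S₃` with cubic resolvent outside `{ℚ(i), ℚ(√−2)}` — none
below 440; the disjunction offered for the dihedral case is a guess by analogy with E-82 (`ℚ(√−Q)`, here `Q = 8`).
TYPER FRAMING (E-desc-98): lens desc; LAW, E-facing (census 8/8), nothing asserted. [conjecture — cell candidate, NOT a tree fact] -/
@[conjecture]
def KMSlackOneEisensteinLawAtEight : Prop :=
  ∀ (W : WeierstrassCurve ℚ) [W.IsElliptic] [NeZero (W.conductorNorm ℤ)]
    (D : ModularParametrizationData W (W.conductorNorm ℤ)) (ε : ℤ),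
    8 ∣ W.conductorNorm ℤ → ¬ 16 ∣ W.conductorNorm ℤ → (ε = 1 ∨ ε = -1) →
      atkinLehnerInvolutionAt (W.conductorNorm ℤ) 2 2 D.f = (ε : ℂ) • D.f →
      lineIndex (kmCuspLattice (W.conductorNorm ℤ)) D.f =
        lineIndex (kmCuspLattice (W.conductorNorm ℤ) ⊓
          LinearMap.ker (wZ (W.conductorNorm ℤ) 2 - ε • LinearMap.id)) D.f →
      (∃ P : W.toAffine.Point, P ≠ 0 ∧ (2 : ℕ) • P = 0) ∨ IsSquare (-2 * W.Δ) ∨ IsSquare (-W.Δ)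

/-! ### REPAIR of E-desc-96 (refuter-1 §R105, 2026-08-29): the binder `N ≠ 8` -/

/-- **E-desc-96R `KMTateLawAtEightR`** — REPAIR of E-desc-96 `KMTateLawAtEight` (refuted AS TYPED at the degenerate level `N = 8`
by `kmTateLawAtEight_false`, p684174; refuter-1's prescription: add the binder `N ≠ 8`, i.e. `M = N/8 ≥ 3` — the only `8 ∥ N`
level where the integer divisions `e₂(M)/2`, `ν₈/4` truncate).  Statement otherwise VERBATIM (LAW KM-8; MEMO-desc §33.4; fitted on
the 27 levels `8M ≤ 440`, `M ≥ 3`, with registered out-of-sample predictions).  Why it might fail: as E-desc-96 (the count at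
`𝔽₂`-rational crossing points with automorphism `i` may change when `e₂(M) = 4`).
TYPER FRAMING (E-desc-96R): lens desc; REPAIRED FITTED LAW (27/27), nothing asserted; supersedes E-desc-96. [conjecture — cell candidate, NOT a tree fact] -/
@[conjecture]
def KMTateLawAtEightR : Prop :=
  ∀ (N : ℕ) [NeZero N], 8 ∣ N → ¬ 16 ∣ N → N ≠ 8 →
    ((tateOrder (kmCuspLattice N) (wZ N 2) 1 : ℤ) =
        2 ^ Int.toNat (ellipticTwoCount (N / 8) / 2 + (if ssRationalCountAtTwo N = 0 then 1 else 0))) ∧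
      ((tateOrder (kmCuspLattice N) (wZ N 2) (-1) : ℤ) =
        2 ^ Int.toNat (ellipticTwoCount (N / 8) / 2 + (if ssRationalCountAtTwo N = 0 then 1 else 0) +
          alFixedPointCount N 8 / 2 - 1))

/-- Bookkeeping edge: the refuted-as-typed E-desc-96 trivially implies its repair (so nothing proved from E-96R is weaker than
what E-96 would have given). -/
theorem kmTateLawAtEightR_of (h : KMTateLawAtEight) : KMTateLawAtEightR :=
  fun N _ h8 h16 _ => h N h8 h16

end Summit.BirchSwinnertonDyer.Rank1Residual.ManinAdditive.KMCuspTate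

end
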